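import Summits.QuantumFields.YangMills.Theorems.BalabanUVNodesN27AtRecord13CoPHomeOn
import Summits.QuantumFields.YangMills.Theorems.BalabanUVNodesN19TargetAtHomes13CoPOn

/-!
«CoP» EDITION (director-ym №152 RULING (β) + node00-def-T KEY-RULE-21: RECORD 13 re-based on print's background `UbgMSCoOfRecord`; the K3 spine ∕ rate homes re-keyed on the
UNCHANGED background-free `θ.Provisos₁₃Core F N` with the datum `datumOfRecord₁₃CoP` and record class `IsRecordOfRecord₁₃CCoP` — dag-n27-c's `…SpineCarriersOfRecord13CoP` for the n20 lineage,
dag-n22-e's `…RateCarriersOfRecord13CoP`, node00-def-RR-2's `Node00.Record13DatumKeyCoP`) of this seat's module 26 (‴ draft typed by g6, farm rc 0, NOT FILED after WORDS-140 — this ⁗ edition is the first filing); the ‴ (stmt-QuantumFields-19912) and ⁗-`Sep`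
editions stay in the tree as aside-lane attachments.  STATEMENTS = the ‴ statements under the token map `Provisos₁₃ ↦ Provisos₁₃Core`, `datumOfRecord₁₃ ↦ datumOfRecord₁₃CoP`,
`Is∕isDatumOfRecord₁₃C ↦ …CCoP`, `IsRecordOfRecord₁₃C ↦ …CCoP`, `RateReading₁₃ ∕ rateCarriersOfRecord₁₃ ∕ RRec₁₃(On) ∕ readingOfRecord₁₃ ↦ …₁₃CoP…`, `SpineReading₁₃ ∕ SRec₁₃(On) ∕ sRec₁₃ ∕ keyed₁₃
∕ homes₁₃ ∕ rec13C ↦ …CoP…`; PROOFS VERBATIM; θ-only declarations NOT renamed.  `--kind proof --supports <K3 id of record> --as helper`.  Generated by this seat's `sep/gen.py`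
(`SEP_SUFFIX=CoP SEP_PROVISOS_SUFFIX=Core`).

# YM-DAG node N21 (= NE7c) AT THE REGIME-RESTRICTED STAGE-13 SPINE HOME `SRec₁₃CoPOn cr Rg` — the weight letter is N21's own output there too: the θ-form face, re-weighting
# invisible to N20 ∕ the extraction clause ∕ the guarded N19′ edge, the weight CHOSEN from a guarded ∃-weight certificate, and dag-n27-c XXXIX's guarded composite
# `spine_rec13CCoPOn_of_homes₁₃CoPOn` (and its CN = K3‴-item class specialisation) with `h21` in the ∃-weight currency — the `SRec₁₃CoPOn` twin of modules 21a §2–§3 + 21c §1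

Track A of `YM-PLAN.md` (cell `pub-ymgap`, HUMAN RULING D-0062), node **N21**; R134 fan-out seat `pub-ymgap-dag-n21-d` (s2 = BY-NAME KNIT at the record), generation 6,
module 26.  THEOREMS ONLY: 0 `def`, 0 `sorry`, standard axioms; COUNT-NEUTRAL; `--supports` the K3⁗ item `SpineGivenEndpointR13Sep` (stmt-QuantumFields-20292) as a helper.
`N`-generic, NO Theses import (restate-immune).  Imports dag-n27-c's XXXIX `BalabanUVNodesN27AtRecord13CoPHomeOn` (p495062: `spine_rec13CCoPOn_of_homes₁₃CoPOn`, `spine_rec13CCoPN_of_homes₁₃CoPOn`;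
brings dag-n20-d's `SRec₁₃CoPOn` ∕ `sRec₁₃CoPOn_self` ∕ `s_N20_sRec₁₃CoPOn_iff` and dag-n22-e's `RRec₁₃CoPOn`).  Restates nothing; cites by name.

WHY.  The K3‴ item quantifies over the GUARDED admissible tuples (`θ.ZtUnity F N ∧ θ.SlotsNondegenerate₁₃ F N`); dag-n27-c's item-facing composites at the regime homes
(`spineGivenEndpointR13_of_homes₁₃CoPOn(_faces)`, `…_of_homes₁₃CoPCN`) read N21 as `h21 : S_N21 (SRec₁₃CoPOn cr Rg)` — a clause on the reading's weight slot `Wsh`.  Every N21 module at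
explicit carriers (5–8, 15, 18b, 20∕20c∕20e, 23b, 24 §3b, 25 §1b) concludes «SOME `Wsh` with `ShellWeightBound … Wsh`»; at the canonical home module 21a turns that into the stub by
re-weighting the reading.  THIS FILE does the same at the regime home, so the guarded composites take N21 with NO clause on the weight slot.

WHAT IS PROVED ([bookkeeping]; `Iff`s, `rfl`-transport, classical choice; each composite ONE application BY NAME).
* §1 (`s_N21_sRec₁₃CoPOn_iff` = dag-n19-d's `N19TargetAtHomes13CoPOn.s_N21_sRec₁₃CoPOn_iff`, CITED — the guarded θ-form: «∀ F θ hP, Rg F θ → θ.Admissible F N → ∀ g₀ os, ShellWeightBound (cr …) … (cr …).Wsh»; dag-n20-d's `s_N20_sRec₁₃CoPOn_iff` pattern) ·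
  `s_N21_sRec₁₃CoPOn_reweight_iff_forall` · `s_N20_sRec₁₃CoPOn_reweight_iff` (re-weighting invisible to N20 at the regime home).
* §2 `exists_reweight_s_N21_sRec₁₃CoPOn` — from a GUARDED ∃-weight certificate, SOME re-weighting `w` with `S_N21 (SRec₁₃CoPOn (re-weighted cr) Rg)` (choice per tuple, `dif` on
  `Rg F θ ∧ θ.Admissible F N`).
* §3 `spine_rec13CCoPOn_of_homes₁₃CoPOn_existsShellWeight` — XXXIX's `spine_rec13CCoPOn_of_homes₁₃CoPOn` (six K4 stubs at `RRec₁₃CoPOn 𝔯 Rg`, `S_N20 (SRec₁₃CoPOn cr Rg)`, the guarded keyed extraction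
  clause `hx`, the same-tuple all-run-lengths guarded edge `h19`) with `h21` REPLACED by the guarded ∃-weight certificate: the reading is re-weighted (§2), `h20` transferred (§1), `hx` and
  `h19` read the re-weighted reading VERBATIM (they never mention `Wsh`), conclusion `Spine ₁₃COn Rg` does not mention the reading;
  `spine_rec13CCoPN_of_homes₁₃CoPOn_existsShellWeight` — the same at `Rg := Node00.unityNondeg₁₃ N`, conclusion `Spine ₁₃CN` = the K3‴ item's class (dag-n27-c XXXVII
  `spineGivenEndpointR13_iff_spine_rec13CCoPN` at `N = 2`).  On the constant-layer road `hW` is ONE application of module 24 §3b ∕ 25 §1b.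

HONEST FRAMING (binding).  Bookkeeping by name: every K4 ∕ K5 stub, the extraction clause and the N19′ edge are HYPOTHESES with NO producer at any record today (0∕1); `cr`, `𝔯`
PARAMETERS (no reading of Bałaban's dressed two-run expansion exists in the tree — NODE O); no inhabitant of any Stage-13 record class claimed (K0‴ open); nothing of Bałaban's
asserted; NE7 ∕ NE7b ∕ NE7c NOT PRINTED for d = 4 and NOT PROVED; **N21 NOT discharged**, N27 NOT discharged, K3‴ NOT claimed; typed 28∕28, discharged count untouched; one finite
four-torus programme at fixed `ε` — NOT ℝ⁴, NOT infinite volume, NOT OS, NOT a mass gap, NOT Clay.  No decl below carries a cite tag.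
-/

set_option autoImplicit false

open Finset

namespace Summit.QuantumFields.YangMills.Theorems.N21AtSRec13CoPOnWeight

open Literature.MathematicalPhysics.QuantumFieldTheory.Balaban1983to89
open Literature.MathematicalPhysics.QuantumFieldTheory.Balaban1983to89.T4Continuum (T4Family ULoop)
open T4ContinuumYM4Torus (ForSmallCouplings)
open T4WeightBudget (RelWeightBound)
open T4IndicatorShell (ShellWeightBound)
open Summit.QuantumFields.BalabanUV.T4Continuum.Spine
open YMDAG.UVSplit
open Node00 (Stage13Params datumOfRecord₁₃CoP IsRecordOfRecord₁₃CCoPOn IsRecordOfRecord₁₃CCoPN)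
open BalabanUVNodesN27SpineRecord (spine_rec13CCoPOn_of_homes₁₃CoPOn spine_rec13CCoPN_of_homes₁₃CoPOn)
open Summit.QuantumFields.YangMills.BalabanUVNodes.N19TargetAtHomes13CoPOn (s_N21_sRec₁₃CoPOn_iff)

variable {N : ℕ} [NeZero N] (cr : SpineReading₁₃CoP N) (Rg : (F : T4Family) → Stage13Params F N → Prop)

/-! ## §1 The guarded θ-form of N21 at the regime home; re-weighting is invisible to N20 -/

-- `s_N21_sRec₁₃CoPOn_iff` (the guarded θ-form of N21 at the regime home) is dag-n19-d's `N19TargetAtHomes13CoPOn.s_N21_sRec₁₃CoPOn_iff` (landed first) — CITED, not re-declared.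

section Reweight

variable (w : (F : T4Family) → (θ : Stage13Params F N) → θ.Provisos₁₃Core F N → (ℕ → ℝ) → List (ULoop F) → ℕ → ℝ)

/-- **N21 AT THE RE-WEIGHTED READING, REGIME HOME**: `S_N21 (SRec₁₃CoPOn (re-weighted cr) Rg)` IS «`ShellWeightBound (cr …) … (w …)` at every guarded admissible tuple». [bookkeeping] -/
theorem s_N21_sRec₁₃CoPOn_reweight_iff_forall :
    S_N21 (SRec₁₃CoPOn (fun F θ hP g₀ os => { cr F θ hP g₀ os with Wsh := w F θ hP g₀ os }) Rg) ↔
      ∀ (F : T4Family) (θ : Stage13Params F N) (hP : θ.Provisos₁₃Core F N), Rg F θ → θ.Admissible F N → ∀ (g₀ : ℕ → ℝ) (os : List (ULoop F)),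
        ShellWeightBound (cr F θ hP g₀ os).l₀ (cr F θ hP g₀ os).T (cr F θ hP g₀ os).A (cr F θ hP g₀ os).B (cr F θ hP g₀ os).shA
          (cr F θ hP g₀ os).shB (w F θ hP g₀ os) :=
  s_N21_sRec₁₃CoPOn_iff _ Rg

/-- **RE-WEIGHTING IS INVISIBLE TO N20 AT THE REGIME HOME** (`RelWeightBound` reads `l₀ T A B Bad W`; dag-n20-d's `s_N20_sRec₁₃CoPOn_iff` twice). [bookkeeping] -/
theorem s_N20_sRec₁₃CoPOn_reweight_iff :
    S_N20 (SRec₁₃CoPOn (fun F θ hP g₀ os => { cr F θ hP g₀ os with Wsh := w F θ hP g₀ os }) Rg) ↔ S_N20 (SRec₁₃CoPOn cr Rg) := by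
  rw [s_N20_sRec₁₃CoPOn_iff, s_N20_sRec₁₃CoPOn_iff]

end Reweight

/-! ## §2 Choosing the weight at the regime home -/

/-- **THE WEIGHT CAN BE CHOSEN, REGIME HOME**: from a GUARDED ∃-weight certificate «at every admissible Stage-13 tuple with provisos in the regime and every `(g₀, os)`, SOME
`Wsh` with `ShellWeightBound (cr …) … Wsh`» (module 24's `exists_shellWeight_keyedOn₁₃CoP_of_constLayer`, module 25's `…_readingOfRecord₁₃CoP`, or any explicit-carrier N21 module read at
guarded tuples), SOME re-weighting `w` of the reading carries `S_N21 (SRec₁₃CoPOn (re-weighted cr) Rg)` (classical choice per tuple).  HYPOTHESIS only; NE7c NOT proved. [folklore] -/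
theorem exists_reweight_s_N21_sRec₁₃CoPOn
    (hW : ∀ (F : T4Family) (θ : Stage13Params F N) (hP : θ.Provisos₁₃Core F N), Rg F θ → θ.Admissible F N → ∀ (g₀ : ℕ → ℝ) (os : List (ULoop F)),
      ∃ Wsh : ℕ → ℝ, ShellWeightBound (cr F θ hP g₀ os).l₀ (cr F θ hP g₀ os).T (cr F θ hP g₀ os).A (cr F θ hP g₀ os).B (cr F θ hP g₀ os).shA
        (cr F θ hP g₀ os).shB Wsh) :
    ∃ w : (F : T4Family) → (θ : Stage13Params F N) → θ.Provisos₁₃Core F N → (ℕ → ℝ) → List (ULoop F) → ℕ → ℝ,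
      S_N21 (SRec₁₃CoPOn (fun F θ hP g₀ os => { cr F θ hP g₀ os with Wsh := w F θ hP g₀ os }) Rg) := by
  classical
  refine ⟨fun F θ hP g₀ os => if hθ : Rg F θ ∧ θ.Admissible F N then (hW F θ hP hθ.1 hθ.2 g₀ os).choose else (cr F θ hP g₀ os).Wsh, ?_⟩
  refine (s_N21_sRec₁₃CoPOn_reweight_iff_forall cr Rg _).2 fun F θ hP hRg hθ g₀ os => ?_
  rw [dif_pos ⟨hRg, hθ⟩]
  exact (hW F θ hP hRg hθ g₀ os).choose_spec

/-! ## §3 dag-n27-c XXXIX's guarded composites with N21 in the ∃-weight currency -/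

/-- **N27 = B5 AT THE REGIME RECORD CLASS FROM THE STUBS AT THE GUARD-RESTRICTED STAGE-13 HOMES, N21 SUPPLIED AS A GUARDED ∃-WEIGHT CERTIFICATE.**  dag-n27-c XXXIX's
`spine_rec13CCoPOn_of_homes₁₃CoPOn` — the six K4 stubs at `RRec₁₃CoPOn 𝔯 Rg`, `S_N20 (SRec₁₃CoPOn cr Rg)`, the guarded keyed extraction clause `hx` (positivity + E1∕E2 under (B), END, small tuned
couplings), the same-tuple all-run-lengths guarded N19′ edge `h19` — with `h21 : S_N21 (SRec₁₃CoPOn cr Rg)` REPLACED by `hW`: the reading is re-weighted by §2, `h20` transferred by §1,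
`hx` ∕ `h19` read the re-weighted reading verbatim, and the conclusion `Spine ₁₃COn Rg` does not mention the reading.  Every binder a HYPOTHESIS (0∕1 today); N21 ∕ N27 NOT
discharged; K3‴ NOT claimed. [bookkeeping] -/
theorem spine_rec13CCoPOn_of_homes₁₃CoPOn_existsShellWeight (𝔯 : RateReading₁₃CoP N)
    (h14 : S_N14 (RRec₁₃CoPOn 𝔯 Rg)) (h15 : S_N15 (RRec₁₃CoPOn 𝔯 Rg)) (h16 : S_N16 (RRec₁₃CoPOn 𝔯 Rg)) (h17 : S_N17 (RRec₁₃CoPOn 𝔯 Rg))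
    (h18 : S_N18 (RRec₁₃CoPOn 𝔯 Rg)) (h22 : S_N22 (RRec₁₃CoPOn 𝔯 Rg)) (h20 : S_N20 (SRec₁₃CoPOn cr Rg))
    (hW : ∀ (F : T4Family) (θ : Stage13Params F N) (hP : θ.Provisos₁₃Core F N), Rg F θ → θ.Admissible F N → ∀ (g₀ : ℕ → ℝ) (os : List (ULoop F)),
      ∃ Wsh : ℕ → ℝ, ShellWeightBound (cr F θ hP g₀ os).l₀ (cr F θ hP g₀ os).T (cr F θ hP g₀ os).A (cr F θ hP g₀ os).B (cr F θ hP g₀ os).shA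
        (cr F θ hP g₀ os).shB Wsh)
    (hx : ∀ (F : T4Family) (θ : Stage13Params F N) (hP : θ.Provisos₁₃Core F N), Rg F θ → θ.Admissible F N →
      B16.EndStatementBPrinted (datumOfRecord₁₃CoP F N θ hP).C → DagBinding.EndpointExistence (datumOfRecord₁₃CoP F N θ hP).C.toB12 →
        ForSmallCouplings (datumOfRecord₁₃CoP F N θ hP) fun g₀ => ∀ os : List (ULoop F),
          0 < (cr F θ hP g₀ os).l₀ ∧ 0 < (cr F θ hP g₀ os).vol ∧
          (∀ (K : ℕ) (t : ℝ), |t| ≤ (cr F θ hP g₀ os).l₀ →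
            T4GenFunBounds.schemeZ ((datumOfRecord₁₃CoP F N θ hP).scheme g₀) os ((cr F θ hP g₀ os).K₀ + K) t =
              ∑ τ ∈ (cr F θ hP g₀ os).T K, (cr F θ hP g₀ os).A K t τ) ∧
          (∀ (K : ℕ) (t : ℝ), |t| ≤ (cr F θ hP g₀ os).l₀ →
            T4GenFunBounds.schemeZ ((datumOfRecord₁₃CoP F N θ hP).scheme g₀) os ((cr F θ hP g₀ os).K₀ + K + 1) t =
              ∑ τ ∈ (cr F θ hP g₀ os).T K, (cr F θ hP g₀ os).B K t τ))
    (h19 : ∀ (F : T4Family) (θ : Stage13Params F N) (hP : θ.Provisos₁₃Core F N), Rg F θ → θ.Admissible F N → ∀ (g₀ : ℕ → ℝ) (os : List (ULoop F)),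
      (∀ k : ℕ, RatesAt (datumOfRecord₁₃CoP F N θ hP) (rateCarriersOfRecord₁₃CoP 𝔯 F θ hP g₀ os k)) → letI := (cr F θ hP g₀ os).dec
        ∃ δ : ℕ → ℝ, NE7.Core (cr F θ hP g₀ os).l₀ (cr F θ hP g₀ os).vol (cr F θ hP g₀ os).T (cr F θ hP g₀ os).Bad
          (fun K t τ => (cr F θ hP g₀ os).A K t τ - (cr F θ hP g₀ os).shA K t τ) (fun K t τ => (cr F θ hP g₀ os).B K t τ - (cr F θ hP g₀ os).shB K t τ) δ ∧
          Summable δ) :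
    Spine (N := N) fun F D w => IsRecordOfRecord₁₃CCoPOn F N Rg D w := by
  obtain ⟨w, h21⟩ := exists_reweight_s_N21_sRec₁₃CoPOn cr Rg hW
  exact spine_rec13CCoPOn_of_homes₁₃CoPOn (fun F θ hP g₀ os => { cr F θ hP g₀ os with Wsh := w F θ hP g₀ os }) 𝔯 Rg h14 h15 h16 h17 h18 h22
    ((s_N20_sRec₁₃CoPOn_reweight_iff cr Rg w).2 h20) h21 (fun F θ hP hRg hθ hB hE => hx F θ hP hRg hθ hB hE) (fun F θ hP hRg hθ g₀ os hr => h19 F θ hP hRg hθ g₀ os hr)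

/-- **N27 = B5 AT THE CN RECORD CLASS (THE K3‴ ITEM's CLASS AT `N = 2`) FROM THE STUBS AT THE GUARD-RESTRICTED HOMES, N21 AS A GUARDED ∃-WEIGHT CERTIFICATE** — the same at
`Rg := Node00.unityNondeg₁₃ N` (print's partition of unity and non-degenerate present slots), XXXIX's `spine_rec13CCoPN_of_homes₁₃CoPOn`; dag-n27-c XXXVII's
`spineGivenEndpointR13_iff_spine_rec13CCoPN` turns the conclusion into the item at `N = 2`.  Every binder a HYPOTHESIS; K3‴ NOT claimed. [bookkeeping] -/
theorem spine_rec13CCoPN_of_homes₁₃CoPOn_existsShellWeight (𝔯 : RateReading₁₃CoP N)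
    (h14 : S_N14 (RRec₁₃CoPOn 𝔯 (Node00.unityNondeg₁₃ N))) (h15 : S_N15 (RRec₁₃CoPOn 𝔯 (Node00.unityNondeg₁₃ N)))
    (h16 : S_N16 (RRec₁₃CoPOn 𝔯 (Node00.unityNondeg₁₃ N))) (h17 : S_N17 (RRec₁₃CoPOn 𝔯 (Node00.unityNondeg₁₃ N))) (h18 : S_N18 (RRec₁₃CoPOn 𝔯 (Node00.unityNondeg₁₃ N)))
    (h22 : S_N22 (RRec₁₃CoPOn 𝔯 (Node00.unityNondeg₁₃ N))) (h20 : S_N20 (SRec₁₃CoPOn cr (Node00.unityNondeg₁₃ N)))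
    (hW : ∀ (F : T4Family) (θ : Stage13Params F N) (hP : θ.Provisos₁₃Core F N), (θ.ZtUnity F N ∧ θ.SlotsNondegenerate₁₃ F N) → θ.Admissible F N →
      ∀ (g₀ : ℕ → ℝ) (os : List (ULoop F)),
      ∃ Wsh : ℕ → ℝ, ShellWeightBound (cr F θ hP g₀ os).l₀ (cr F θ hP g₀ os).T (cr F θ hP g₀ os).A (cr F θ hP g₀ os).B (cr F θ hP g₀ os).shA
        (cr F θ hP g₀ os).shB Wsh)
    (hx : ∀ (F : T4Family) (θ : Stage13Params F N) (hP : θ.Provisos₁₃Core F N), (θ.ZtUnity F N ∧ θ.SlotsNondegenerate₁₃ F N) → θ.Admissible F N →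
      B16.EndStatementBPrinted (datumOfRecord₁₃CoP F N θ hP).C → DagBinding.EndpointExistence (datumOfRecord₁₃CoP F N θ hP).C.toB12 →
        ForSmallCouplings (datumOfRecord₁₃CoP F N θ hP) fun g₀ => ∀ os : List (ULoop F),
          0 < (cr F θ hP g₀ os).l₀ ∧ 0 < (cr F θ hP g₀ os).vol ∧
          (∀ (K : ℕ) (t : ℝ), |t| ≤ (cr F θ hP g₀ os).l₀ →
            T4GenFunBounds.schemeZ ((datumOfRecord₁₃CoP F N θ hP).scheme g₀) os ((cr F θ hP g₀ os).K₀ + K) t =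
              ∑ τ ∈ (cr F θ hP g₀ os).T K, (cr F θ hP g₀ os).A K t τ) ∧
          (∀ (K : ℕ) (t : ℝ), |t| ≤ (cr F θ hP g₀ os).l₀ →
            T4GenFunBounds.schemeZ ((datumOfRecord₁₃CoP F N θ hP).scheme g₀) os ((cr F θ hP g₀ os).K₀ + K + 1) t =
              ∑ τ ∈ (cr F θ hP g₀ os).T K, (cr F θ hP g₀ os).B K t τ))
    (h19 : ∀ (F : T4Family) (θ : Stage13Params F N) (hP : θ.Provisos₁₃Core F N), (θ.ZtUnity F N ∧ θ.SlotsNondegenerate₁₃ F N) → θ.Admissible F N →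
      ∀ (g₀ : ℕ → ℝ) (os : List (ULoop F)), (∀ k : ℕ, RatesAt (datumOfRecord₁₃CoP F N θ hP) (rateCarriersOfRecord₁₃CoP 𝔯 F θ hP g₀ os k)) → letI := (cr F θ hP g₀ os).dec
        ∃ δ : ℕ → ℝ, NE7.Core (cr F θ hP g₀ os).l₀ (cr F θ hP g₀ os).vol (cr F θ hP g₀ os).T (cr F θ hP g₀ os).Bad
          (fun K t τ => (cr F θ hP g₀ os).A K t τ - (cr F θ hP g₀ os).shA K t τ) (fun K t τ => (cr F θ hP g₀ os).B K t τ - (cr F θ hP g₀ os).shB K t τ) δ ∧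
          Summable δ) :
    Spine (N := N) fun F D w => IsRecordOfRecord₁₃CCoPN F N D w := by
  obtain ⟨w, h21⟩ := exists_reweight_s_N21_sRec₁₃CoPOn cr (Node00.unityNondeg₁₃ N) hW
  exact spine_rec13CCoPN_of_homes₁₃CoPOn (fun F θ hP g₀ os => { cr F θ hP g₀ os with Wsh := w F θ hP g₀ os }) 𝔯 h14 h15 h16 h17 h18 h22
    ((s_N20_sRec₁₃CoPOn_reweight_iff cr _ w).2 h20) h21 (fun F θ hP hRg hθ hB hE => hx F θ hP hRg hθ hB hE) (fun F θ hP hRg hθ g₀ os hr => h19 F θ hP hRg hθ g₀ os hr)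

end Summit.QuantumFields.YangMills.Theorems.N21AtSRec13CoPOnWeight
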